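import Mathlib
import Literature.Analysis.ODE.InverseSquareLadder
import Literature.Analysis.ODE.InverseSquareLadderPolynomial
import Literature.Analysis.ODE.LadderIntertwine
import Literature.Analysis.ODE.LadderBoundaryForm
import HarnessLib

/-!
# The ladder boundary form of an odd polynomial at the edge of a gap: `−∫_0^R p⁽ⁿ⁾ q⁽ⁿ⁾`

Analysis/ODE support file (everything proved, no definitions). Let `p, q ∈ ℝ[X]` be ODD polynomials
(all even coefficients vanish), `deg p < 2n`. With `ι = 1/x` on `(0, ∞)` `p` lies in the kernel of
the ladder `L_n = ladder ι n` (`ladder_polynomial_eq_zero`: the ladder coefficient of `x^m` is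
`Π_{l<n}(m − 2l − 1)`, `InverseSquareLadderPolynomial.lean`), so by the differential identity of
`LadderBoundaryForm.lean` the boundary form `ladderBdry ι n p q` has derivative `−p⁽ⁿ⁾q⁽ⁿ⁾` on
`(0, ∞)`; and it tends to `0` at `0⁺` (`tendsto_ladderBdry_polynomial_zero`: every ladder of an odd
polynomial tends to `0` there, and `p⁽ⁿ⁺¹⁾(0) q⁽ⁿ⁾(0) = 0` by parity). Hence, for every smooth `ι`
equal to `x⁻¹` on `[½, ∞)` and every `R > ½`,

  `ladderBdry ι n p q R = −∫_0^R p⁽ⁿ⁾ q⁽ⁿ⁾`   (`ladderBdry_polynomial_eq_neg_integral`).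

This evaluates the only boundary term in the ladder isometry for data vanishing on a gap `[0, R]`
(`LadderIsometry.lean`), the algebraic core of the odd-dimensional exterior-energy
identity with apex at the centre (Duyckaerts–Kenig–Merle; Kenig–Lawrie–Liu–Schlag 2015 §2), route
PhotonSphereChannels, `WindowedShellChannels` (stmt-FinalStateConjecture-14085), far side. Folklore.
-/

noncomputable section

namespace Literature.Analysis.ODE

open Set Filter Topology Finset Real Polynomial

variable {ι : ℝ → ℝ}

/-! ### Ladders of power sums above a threshold -/

/-- **The ladder of a power sum**, threshold form: for `ι = x⁻¹` on `(c,∞)`, `c ≥ 0`,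
`ladder ι k (Σ_{m≤N} e_m x^m) = Σ_{m≤N} e_m Π_{l<k}(m − 2l − 1) x^{m−k}` there. [folklore] -/
theorem ladder_powerSum_Ioi {c : ℝ} (hc : 0 ≤ c) (hιeq : ∀ x, c < x → ι x = x⁻¹) (e : ℕ → ℝ)
    (N : ℕ) : ∀ k : ℕ, ∀ x, c < x →
      ladder ι k (fun z => ∑ m ∈ range (N + 1), e m * z ^ m) x
        = ∑ m ∈ range (N + 1), e m * (∏ l ∈ range k, ((m : ℝ) - 2 * l - 1)) * x ^ ((m : ℝ) - k) := by
  intro k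
  induction k with
  | zero =>
    intro x hx
    simp only [ladder_zero, Finset.prod_range_zero, mul_one, Nat.cast_zero, sub_zero, rpow_natCast]
  | succ k ih =>
    intro x hx
    have hx0 : 0 < x := lt_of_le_of_lt hc hx
    rw [ladder_succ, ladderStep_apply]
    have hloc : ladder ι k (fun z => ∑ m ∈ range (N + 1), e m * z ^ m) =ᶠ[𝓝 x]
        fun y => ∑ m ∈ range (N + 1), e m * (∏ l ∈ range k, ((m : ℝ) - 2 * l - 1))
          * y ^ ((m : ℝ) - k) :=
      Filter.mem_of_superset (Ioi_mem_nhds hx) fun y hy => ih y hy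
    have hder : HasDerivAt (fun y => ∑ m ∈ range (N + 1),
        e m * (∏ l ∈ range k, ((m : ℝ) - 2 * l - 1)) * y ^ ((m : ℝ) - k))
        (∑ m ∈ range (N + 1), e m * (∏ l ∈ range k, ((m : ℝ) - 2 * l - 1))
          * (((m : ℝ) - k) * x ^ ((m : ℝ) - k - 1))) x :=
      HasDerivAt.fun_sum fun m _ =>
        (Real.hasDerivAt_rpow_const (p := (m : ℝ) - k) (Or.inl hx0.ne')).const_mul _
    rw [(hder.congr_of_eventuallyEq hloc).deriv, ih x hx, hιeq x hx, Finset.mul_sum,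
      ← Finset.sum_sub_distrib]
    refine Finset.sum_congr rfl fun m _ => ?_
    rw [Finset.prod_range_succ]
    have h1 : x⁻¹ * x ^ ((m : ℝ) - k) = x ^ ((m : ℝ) - k - 1) := by
      rw [← rpow_neg_one, ← rpow_add hx0]; ring_nf
    have h2 : x ^ ((m : ℝ) - ((k + 1 : ℕ) : ℝ)) = x ^ ((m : ℝ) - k - 1) := by
      push_cast; ring_nf
    rw [h2]
    calc e m * (∏ l ∈ range k, ((m : ℝ) - 2 * l - 1)) * (((m : ℝ) - k) * x ^ ((m : ℝ) - k - 1))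
          - ((k + 1 : ℕ) : ℝ) * x⁻¹ * (e m * (∏ l ∈ range k, ((m : ℝ) - 2 * l - 1)) * x ^ ((m : ℝ) - k))
        = e m * (∏ l ∈ range k, ((m : ℝ) - 2 * l - 1)) * (((m : ℝ) - k) * x ^ ((m : ℝ) - k - 1))
          - ((k + 1 : ℕ) : ℝ) * (e m * (∏ l ∈ range k, ((m : ℝ) - 2 * l - 1))
            * (x⁻¹ * x ^ ((m : ℝ) - k))) := by ring
      _ = e m * ((∏ l ∈ range k, ((m : ℝ) - 2 * l - 1)) * ((m : ℝ) - 2 * k - 1))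
          * x ^ ((m : ℝ) - k - 1) := by rw [h1]; push_cast; ring

/-! ### Odd polynomials: ladders in the kernel and behaviour at `0⁺` -/

/-- A polynomial as a power sum over `range (natDegree + 1)`. [folklore] -/
theorem polynomial_eval_eq_powerSum (p : ℝ[X]) :
    (fun x : ℝ => p.eval x) = fun x => ∑ m ∈ range (p.natDegree + 1), p.coeff m * x ^ m :=
  funext fun x => eval_eq_sum_range' (Nat.lt_succ_self _) x

/-- **Odd polynomials of degree `< 2n` lie in the kernel of `ladder ι n`** wherever `ι = x⁻¹`
(on `(c, ∞)`, `c ≥ 0`). [folklore] -/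
theorem ladder_polynomial_eq_zero {c : ℝ} (hc : 0 ≤ c) (hιeq : ∀ x, c < x → ι x = x⁻¹)
    {n : ℕ} {p : ℝ[X]} (hodd : ∀ i, Even i → p.coeff i = 0) (hdeg : p.natDegree < 2 * n)
    {x : ℝ} (hx : c < x) : ladder ι n (fun y => p.eval y) x = 0 := by
  rw [polynomial_eval_eq_powerSum p, ladder_powerSum_Ioi hc hιeq _ _ n x hx]
  refine Finset.sum_eq_zero fun m hm => ?_
  by_cases he : Even m
  · rw [hodd m he]; ring
  · have hmo : Odd m := Nat.not_even_iff_odd.1 he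
    have hm2 : m < 2 * n := lt_of_le_of_lt (Nat.lt_succ_iff.1 (mem_range.1 hm)) hdeg
    rw [ladder_coeff_eq_zero_of_odd hmo hm2]; ring

/-- **Ladders of odd polynomials tend to `0` at `0⁺`** (for `ι = x⁻¹` on `(0,∞)`). [folklore] -/
theorem tendsto_ladder_polynomial_zero (hιeq : ∀ x, 0 < x → ι x = x⁻¹) (k : ℕ) {p : ℝ[X]}
    (hodd : ∀ i, Even i → p.coeff i = 0) :
    Tendsto (ladder ι k fun y => p.eval y) (𝓝[>] 0) (𝓝 0) := by
  have hev : (ladder ι k fun y => p.eval y) =ᶠ[𝓝[>] 0] fun x =>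
      ∑ m ∈ range (p.natDegree + 1), p.coeff m * (∏ l ∈ range k, ((m : ℝ) - 2 * l - 1))
        * x ^ ((m : ℝ) - k) := by
    filter_upwards [self_mem_nhdsWithin] with x hx
    rw [polynomial_eval_eq_powerSum p, ladder_powerSum_Ioi le_rfl hιeq _ _ k x hx]
  refine Tendsto.congr' hev.symm ?_
  have key : ∀ m ∈ range (p.natDegree + 1), Tendsto (fun x : ℝ =>
      p.coeff m * (∏ l ∈ range k, ((m : ℝ) - 2 * l - 1)) * x ^ ((m : ℝ) - k)) (𝓝[>] 0) (𝓝 0) := by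
    intro m _
    by_cases he : Even m
    · simp only [hodd m he, zero_mul]; exact tendsto_const_nhds
    · have hmo : Odd m := Nat.not_even_iff_odd.1 he
      by_cases hmk : m < 2 * k
      · simp only [ladder_coeff_eq_zero_of_odd hmo hmk, mul_zero, zero_mul]
        exact tendsto_const_nhds
      · -- positive exponent
        have hpos : 0 < (m : ℝ) - k := by
          have : 2 * k + 1 ≤ m := by rcases hmo with ⟨j, rfl⟩; omega
          have : ((2 * k + 1 : ℕ) : ℝ) ≤ m := by exact_mod_cast this
          push_cast at this; linarith
        have h0 : Tendsto (fun x : ℝ => x ^ ((m : ℝ) - k)) (𝓝[>] 0) (𝓝 0) := by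
          have hc : Continuous fun x : ℝ => x ^ ((m : ℝ) - k) := continuous_rpow_const hpos.le
          have h1 : Tendsto (fun x : ℝ => x ^ ((m : ℝ) - k)) (𝓝[>] 0) (𝓝 ((0 : ℝ) ^ ((m : ℝ) - k))) :=
            tendsto_nhdsWithin_of_tendsto_nhds (hc.tendsto 0)
          rwa [zero_rpow hpos.ne'] at h1
        simpa using h0.const_mul (p.coeff m * ∏ l ∈ range k, ((m : ℝ) - 2 * l - 1))
  have := tendsto_finsetSum (range (p.natDegree + 1)) key
  simpa using this

/-- Iterated derivatives of a polynomial function are the evaluations of the iterated formal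
derivatives. [folklore] -/
theorem iteratedDeriv_polynomial_eval (p : ℝ[X]) (j : ℕ) :
    iteratedDeriv j (fun x : ℝ => p.eval x) = fun x => (derivative^[j] p).eval x := by
  induction j with
  | zero => simp
  | succ j ih =>
    rw [iteratedDeriv_succ, ih]
    funext x
    rw [Function.iterate_succ_apply']
    exact ((derivative^[j] p).hasDerivAt x).deriv

/-- The second derivative of an odd polynomial is an odd polynomial. [folklore] -/
theorem odd_iterate_derivative_two {p : ℝ[X]} (hodd : ∀ i, Even i → p.coeff i = 0) :
    ∀ i, Even i → (derivative^[2] p).coeff i = 0 := by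
  intro i hi
  rw [coeff_iterate_derivative]
  have : Even (i + 2) := hi.add (by decide)
  rw [hodd _ this]; simp

/-- `p⁽ⁿ⁺¹⁾(0) · q⁽ⁿ⁾(0) = 0` for odd polynomials `p, q`. [folklore] -/
theorem iteratedDeriv_polynomial_mul_eq_zero_at_zero {p q : ℝ[X]} (hp : ∀ i, Even i → p.coeff i = 0)
    (hq : ∀ i, Even i → q.coeff i = 0) (n : ℕ) :
    iteratedDeriv (n + 1) (fun x : ℝ => p.eval x) 0 * iteratedDeriv n (fun x : ℝ => q.eval x) 0 = 0 := by
  rw [iteratedDeriv_polynomial_eval, iteratedDeriv_polynomial_eval]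
  simp only [← coeff_zero_eq_eval_zero, coeff_iterate_derivative, zero_add]
  rcases Nat.even_or_odd n with hn | hn
  · rw [hq n hn]; simp
  · have : Even (n + 1) := hn.add_one
    rw [hp _ this]; simp

/-- **The boundary form of odd polynomials tends to `0` at `0⁺`** (`ι = x⁻¹` on `(0,∞)`).
[folklore] -/
theorem tendsto_ladderBdry_polynomial_zero (hιeq : ∀ x, 0 < x → ι x = x⁻¹) :
    ∀ (n : ℕ) {p q : ℝ[X]}, (∀ i, Even i → p.coeff i = 0) → (∀ i, Even i → q.coeff i = 0) →
      Tendsto (ladderBdry ι n (fun x => p.eval x) (fun x => q.eval x)) (𝓝[>] 0) (𝓝 0) := by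
  intro n
  induction n with
  | zero =>
    intro p q _ _
    have : ladderBdry ι 0 (fun x => p.eval x) (fun x => q.eval x) = fun _ => 0 := funext fun _ => rfl
    rw [this]; exact tendsto_const_nhds
  | succ n ih =>
    intro p q hp hq
    have hfun : ladderBdry ι (n + 1) (fun x => p.eval x) (fun x => q.eval x) = fun y =>
        ladder ι (n + 1) (fun x => p.eval x) y * ladder ι n (fun x => q.eval x) y
        - iteratedDeriv (n + 1) (fun x => p.eval x) y * iteratedDeriv n (fun x => q.eval x) y
        - ladderBdry ι n (fun x => (derivative^[2] p).eval x) (fun x => q.eval x) y := by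
      funext y
      rw [ladderBdry_succ, iteratedDeriv_polynomial_eval p 2]
    rw [hfun]
    have h1 := (tendsto_ladder_polynomial_zero hιeq (n + 1) hp).mul
      (tendsto_ladder_polynomial_zero hιeq n hq)
    have h2 : Tendsto (fun y => iteratedDeriv (n + 1) (fun x => p.eval x) y
        * iteratedDeriv n (fun x => q.eval x) y) (𝓝[>] 0) (𝓝 0) := by
      have hc : Continuous fun y => iteratedDeriv (n + 1) (fun x => p.eval x) y
          * iteratedDeriv n (fun x => q.eval x) y := by
        rw [iteratedDeriv_polynomial_eval, iteratedDeriv_polynomial_eval]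
        exact (Polynomial.continuous _).mul (Polynomial.continuous _)
      have h2' : Tendsto (fun y => iteratedDeriv (n + 1) (fun x => p.eval x) y
          * iteratedDeriv n (fun x => q.eval x) y) (𝓝[>] 0)
          (𝓝 (iteratedDeriv (n + 1) (fun x => p.eval x) 0 * iteratedDeriv n (fun x => q.eval x) 0)) :=
        tendsto_nhdsWithin_of_tendsto_nhds (hc.tendsto 0)
      rwa [iteratedDeriv_polynomial_mul_eq_zero_at_zero hp hq n] at h2'
    have h3 := ih (odd_iterate_derivative_two hp) hq
    simpa using (h1.sub h2).sub h3

/-- Polynomial functions are smooth. [folklore] -/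
theorem contDiff_polynomial_eval (p : ℝ[X]) (N : ℕ∞) : ContDiff ℝ N (fun x : ℝ => p.eval x) := by
  rw [polynomial_eval_eq_powerSum p]
  exact ContDiff.sum fun m _ => contDiff_const.mul (contDiff_id.pow m)

/-! ### The boundary form at the edge of the gap -/

/-- **The gap evaluation.** For a smooth `ι` with `ι = x⁻¹` on `[½, ∞)`, odd polynomials `p, q` with
`deg p < 2n`, and `R > ½`: `ladderBdry ι n p q R = −∫_0^R p⁽ⁿ⁾ q⁽ⁿ⁾`. [cite: KenigEtAl2015, §2] -/
theorem ladderBdry_polynomial_eq_neg_integral (hιeq : ∀ x : ℝ, 1 / 2 ≤ x → ι x = x⁻¹) {n : ℕ}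
    {p q : ℝ[X]} (hp : ∀ i, Even i → p.coeff i = 0) (hq : ∀ i, Even i → q.coeff i = 0)
    (hpdeg : p.natDegree < 2 * n) {R : ℝ} (hR : 1 / 2 < R) :
    ladderBdry ι n (fun x => p.eval x) (fun x => q.eval x) R
      = -∫ x in (0 : ℝ)..R, iteratedDeriv n (fun x => p.eval x) x * iteratedDeriv n (fun x => q.eval x) x := by
  set P : ℝ → ℝ := fun x => p.eval x with hP
  set Q : ℝ → ℝ := fun x => q.eval x with hQ
  set ι₀ : ℝ → ℝ := fun x => x⁻¹ with hι₀
  set G : ℝ → ℝ := ladderBdry ι₀ n P Q with hG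
  set h : ℝ → ℝ := fun x => iteratedDeriv n P x * iteratedDeriv n Q x with hh
  have hR0 : 0 < R := by linarith
  have hPC : ContDiff ℝ ((2 * n : ℕ) : ℕ∞) P := contDiff_polynomial_eval p _
  have hQC : ContDiff ℝ ((n + 1 : ℕ) : ℕ∞) Q := contDiff_polynomial_eval q _
  have hcont : Continuous h := by
    rw [hh, iteratedDeriv_polynomial_eval, iteratedDeriv_polynomial_eval]
    exact (Polynomial.continuous _).mul (Polynomial.continuous _)
  -- Step 1: `G R − G y = −∫_y^R h` for `0 < y ≤ R`
  have hstep : ∀ y, 0 < y → y ≤ R → G R - G y = -∫ x in y..R, h x := by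
    intro y hy hyR
    obtain ⟨ι₁, hι₁, hι₁eq, hric⟩ := exists_smooth_inv_extension_Ici (half_pos hy)
    have hι₁' : ∀ x, y / 2 < x → ι₁ x = x⁻¹ := fun x hx => hι₁eq x hx.le
    have hI := integral_ladder_mul_ladder_sub_eq hι₁ isOpen_Ioi hric n hPC hQC hyR
      (fun x hx => show y / 2 < x by linarith [hx.1])
    -- the ladders vanish on `(y/2, ∞)`
    have hint : (∫ x in y..R, (ladder ι₁ n P x * ladder ι₁ n Q x
        - iteratedDeriv n P x * iteratedDeriv n Q x)) = -∫ x in y..R, h x := by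
      rw [← intervalIntegral.integral_neg]
      refine intervalIntegral.integral_congr fun x hx => ?_
      rw [uIcc_of_le hyR] at hx
      have hx' : y / 2 < x := by linarith [hx.1]
      show ladder ι₁ n P x * ladder ι₁ n Q x - iteratedDeriv n P x * iteratedDeriv n Q x = -h x
      rw [ladder_polynomial_eq_zero (half_pos hy).le hι₁' hp hpdeg hx']
      simp [hh]
    -- locality: `ladderBdry ι₁ = ladderBdry ι₀` on `(y/2, ∞)`
    have hloc : ∀ z, y / 2 < z → ladderBdry ι₁ n P Q z = G z := by
      intro z hz
      refine ladderBdry_congr_eventuallyEq n ?_ EventuallyEq.rfl EventuallyEq.rfl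
      filter_upwards [Ioi_mem_nhds hz] with w hw using hι₁' w hw
    rw [hint, hloc R (by linarith), hloc y (by linarith)] at hI
    linarith
  -- Step 2: let `y → 0⁺`
  have hlim : Tendsto G (𝓝[>] 0) (𝓝 0) :=
    tendsto_ladderBdry_polynomial_zero (fun x _ => rfl) n hp hq
  have hprim : Continuous fun y => ∫ x in (0 : ℝ)..y, h x :=
    intervalIntegral.continuous_primitive (fun a b => hcont.intervalIntegrable a b) 0
  have hev : G =ᶠ[𝓝[>] 0] fun y => G R + (∫ x in (0:ℝ)..R, h x) - ∫ x in (0:ℝ)..y, h x := by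
    have hmem : Ioo (0 : ℝ) R ∈ 𝓝[>] (0 : ℝ) := Ioo_mem_nhdsGT hR0
    filter_upwards [hmem] with y hy
    have e := hstep y hy.1 hy.2.le
    have hadd : (∫ x in (0:ℝ)..y, h x) + ∫ x in y..R, h x = ∫ x in (0:ℝ)..R, h x :=
      intervalIntegral.integral_add_adjacent_intervals (hcont.intervalIntegrable _ _)
        (hcont.intervalIntegrable _ _)
    linarith
  have hlim2 : Tendsto (fun y => G R + (∫ x in (0:ℝ)..R, h x) - ∫ x in (0:ℝ)..y, h x) (𝓝[>] 0)
      (𝓝 (G R + (∫ x in (0:ℝ)..R, h x) - 0)) := by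
    have h0 : Tendsto (fun y => ∫ x in (0:ℝ)..y, h x) (𝓝[>] 0) (𝓝 0) := by
      have h0' : Tendsto (fun y => ∫ x in (0:ℝ)..y, h x) (𝓝[>] 0) (𝓝 (∫ x in (0:ℝ)..0, h x)) :=
        tendsto_nhdsWithin_of_tendsto_nhds (hprim.tendsto 0)
      simpa using h0'
    exact tendsto_const_nhds.sub h0
  have huniq := tendsto_nhds_unique (hlim.congr' hev) hlim2
  -- Step 3: `ladderBdry ι = G` at `R`
  have hlocR : ladderBdry ι n P Q R = G R := by
    refine ladderBdry_congr_eventuallyEq n ?_ EventuallyEq.rfl EventuallyEq.rfl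
    filter_upwards [Ioi_mem_nhds hR] with w hw using hιeq w (le_of_lt hw)
  rw [hlocR]
  linarith

end Literature.Analysis.ODE
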